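import Mathlib
import Literature.MathematicalPhysics.QuantumFieldTheory.Balaban1983to89.B16Improved189ArbitraryRegion

/-!
# `Balaban1983to89.B16Improved189FullBudgetIndex` — [Balaban1989LargeFieldII] pp. 384–387: the strengthened inductive
statement (1.80)⁺ of `B16Improved189FullBudget` INHABITED IN THE CELL'S ℤᵈ INDEX MODEL — birth (1.82), the reset of
p. 386 and the merger (1.85)–(1.88) with the terminal term; the merger's terminal binder `htsub` DISCHARGED

T. Bałaban, *Large field renormalization. II. Localization, exponentiation, and bounds for the 𝐑 operation*, Commun.
Math. Phys. **122** (1989) 355–392, doi:10.1007/bf01238433 [Balaban1989LargeFieldII] (cell paper B16 = [V]; PDF held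
`paper:balaban1989-cmp122-large-field-ii`, journal page = PDF page + 354; pp. 384–387 = PDF 30–33).

statement-level bookkeeping of a published proof with citation tags; proofs kernel-checked; nothing here is a claim
about the Yang–Mills mass gap

CITATION HEADER / WHAT IS REPRODUCED.  p. 387 [PDF 33] ll. 25–29, verbatim: *"Next, we have noticed already that the
inequality (1.79) holds for the 𝐓-operation connected with an arbitrary large field region. The inequality (1.80)
holds quite generally for such regions, hence also an improved bound (1.89), with the additional term −κ₁d_k(X) in the
exponential. This implies the inequality (2.50) [III], hence Corollary 3."*  p. 384 [30]: *"the number K is the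
smallest positive integer having the property that the domain S^K(Z) … satisfies the conditions (i), (ii), with N = R_j.
More precisely this means that κ_j(Z) ≧ Σ_{n=j+1}^{j+K} O(1)M^dR_n^{d+1}d′_n(S^{n−j}(Z)). (1.80)"*; the cases (1.82) p. 385,
the reset p. 386 ll. 1–3 (*"because Z is a small domain"*), the merger (1.85)–(1.88) pp. 386–387 (*"for p₀ large and γ
small enough"*) as quoted in `B16Lem384Induction` ∕ `B16Improved189FullBudget`.  [IV] = [Balaban1989LargeFieldI] p. 177
condition (i); [III] = [Balaban1988Convergent] (2.9) p. 255 (`R_n ≤ LR_m`); [B12] = [Balaban1987RG1] p. 257 (`d_j(X)`).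

THE LOCATED ITEM THIS FILE ANSWERS.  `B16Improved189FullBudget` (p411685) re-runs the printed induction for the
inductive statement STRENGTHENED by a terminal term, (1.80)⁺ `κ_j(Z) ≧ Σ_{n=j+1}^{j+K} O(1)M^dR_n^{d+1}d′_n(S^{n−j}(Z)) +
t_j(Z)`, `t_j(Z) = κ₁d_{j+K}(S^K(Z))`, in the bookkeeping model (`Controls b j K (κ − t) s`), and derives from it the
FULL-BUDGET improved (1.89) `𝐓′_k(X)1 ≤ exp(−2(1+β₀)⁻¹p₀(g_k) − κ₁d_k(X))` (`improved189_full_of_history`); its §7 and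
`B16Improved189ArbitraryRegion` §7 (n13-d) reduce the two terminal binders (`ht` at birth∕reset, the merger's `htsub`)
to condition (i) at the terminal scale — BY THE DEFINITION OF THE HORIZON the terminal index set `S^K(Z)` of ANY
component satisfies (i) at its own scale, so every terminal term obeys the ABSOLUTE bound `t ≤ κ₁((Nsz·R)^d − 1)`.  What
NO tree file does: inhabit the strengthened cases in the ℤᵈ index model in which `B16Lem384Induction` §§7–10 inhabit the
UNstrengthened ones (`exists_birth_ofIndex`, `exists_reset_ofIndex`, `MergeIndex`), and assemble base + step + capstone
there.  THIS FILE does exactly that; the located conditions change by constants only, as in p411685: `3Q ≤ a` at birth,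
`+ κ₁((Nsz·R)^d − 1)` at the reset, `E + E_t + D ≤ q` at the merger — print's *"p₀ large, and g₁ sufficiently small"* ∕
*"p₀ large and γ small enough"*, which name no constant.

WHAT THIS FILE PROVES (kernel-checked, zero `sorry`, theorems only — no `def`; axioms standard; BY NAME over
`B16Improved189FullBudget` §§2–5, §7, `B16Improved189ArbitraryRegion` §7, `B16Lem384Induction` §§7–10,
`B16CubeCurrency.exponents_log`, `B16SProfile` — nothing re-proved):
§1 `htsub_of_abs_bound` (the merger's binder for any non-negative bounded assignment — abstract form of n13-d's
   `htsub_of_condI`); `terminal_pow_le_of_flow` ∕ `terminal_le_located` (`κ₁·d ≤ κ₁((Nsz·L·R_m)^d − 1)` along the flow,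
   `terminal_le_const_of_condI` BY NAME + (2.9)).
§2 **`controlsT_birth_ofIndex`** — (1.80)⁺ AT THE CREATION SCALE, END TO END: the hypotheses of `controls_ofIndex`
   verbatim, plus `κ₁ ≥ 0`, condition (i) for the terminal iterate, the clause `κ₁((Nsz·R_{m+K})^d − 1) ≤ Q`, `3Q ≤ a`.
§3 **`controlsT_reset_ofIndex`** — (1.80)⁺ FOR THE RESET COMPONENT, END TO END: the hypotheses of
   `controls_reset_ofIndex` verbatim with the located condition charged `+ κ₁((Nsz·R_{j+1+K})^d − 1)`; condition (i) for
   the terminal iterate DERIVED («Z is a small domain»).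
§4 **`mergeT_controls_ofIndex`** — (1.80)⁺ FOR THE MERGED COMPONENT over `MergeIndex` data, `hsingleT` DISCHARGED
   (`hsingleT_old` / `hsingleT_new`), `htsub` DISCHARGED (§1), located `hbudgetT : E + E_t + cost(2) ≤ 2(1+β₀)⁻¹p₀(g_{j+1})`.
§5 `invariantT_succ_of_certificates` (the step from one printed-case certificate per component),
   **`invariantT_base_ofIndex`**, and the capstone **`improved189_full_ofIndex`** — the FULL-BUDGET improved (1.89) for a
   horizon-`0` component from base data read from index regions and a (1.80)⁺-step at every scale.
HONEST SCOPE / A6.  (a) Index model (cell DIVERGENCE D-b02g9.1: its identification with print's domains is NOT claimed);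
`O(1)` not fixed; `Clean` a parameter predicate; `K` any horizon inside the flow not exceeding a stopping index;
condition (i) for the terminal iterate is an INPUT at birth (= the definition of `K` for a stopping index) and DERIVED at
the reset.  (b) The flow hypotheses of [III] §2 (`hI hR hbR h29a h27 hΘ`) are carried exactly as in `B16Lem384Induction`
§§8–10 and are NOT jointly inhabited here — LOCATED; the strengthened bookkeeping hypotheses are jointly satisfiable with
a non-zero term by p411685 §6 `toy_history_full`; §1 and §5's step are hypothesis-light.  (c) The merger keeps print's
`hsub` (p. 387 ll. 3–12) and the located `hbudgetT` as named inputs, as `MergeIndex` does.  (d) Whether (2.50) [III]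
needs the full or the halved budget is unprinted (GAPS G-adv3-1, G-adv3-2, G-B16-08 (c)); this file only makes the
full-budget route of G-adv3-6 (3) kernel-complete in the index model modulo located clauses.  (e) Nothing of
(1.79)–(1.89) is asserted about Bałaban's densities; N13 NOT discharged; count-neutral; NOT summit progress — one finite
𝕋⁴ programme at fixed ε, Bałaban AS PRINTED; R4 closes the conditional finite-𝕋⁴ rung `BalabanLadder.UV` only, nothing
continuum / mass gap.  Seat `pub-ymgap-dag-n13-w2` (g0), YM-DAG node N13 [B16], `--supports stmt-QuantumFields-20542`.
-/

namespace Literature.MathematicalPhysics.QuantumFieldTheory.Balaban1983to89.B16Improved189FullBudgetIndex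

open Literature.MathematicalPhysics.QuantumFieldTheory.Balaban1983to89
open Literature.MathematicalPhysics.QuantumFieldTheory.Balaban1983to89.Step
open Literature.MathematicalPhysics.QuantumFieldTheory.Balaban1983to89.Step.Budget
open Literature.MathematicalPhysics.QuantumFieldTheory.Balaban1983to89.B16Improved189FullBudget
open Literature.MathematicalPhysics.QuantumFieldTheory.Balaban1983to89.B16Lem384Induction
open Literature.MathematicalPhysics.QuantumFieldTheory.Balaban1983to89.B13ScaleTransfer
open Literature.MathematicalPhysics.QuantumFieldTheory.Balaban1983to89.TreeLength
open Literature.MathematicalPhysics.QuantumFieldTheory.Balaban1983to89.B16SProfile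
open Literature.MathematicalPhysics.QuantumFieldTheory.Balaban1983to89.B16StoppingRule
open Literature.MathematicalPhysics.QuantumFieldTheory.Balaban1983to89.B16CubeCurrency
open Literature.MathematicalPhysics.QuantumFieldTheory.Balaban1983to89.B16MergeGeometry
open Literature.MathematicalPhysics.QuantumFieldTheory.Balaban1983to89.B13Factor210Literal (fineCubes)
open Literature.MathematicalPhysics.QuantumFieldTheory.Balaban1983to89.B16Improved189ArbitraryRegion
  (terminal_le_const_of_condI)

noncomputable section

variable {d : ℕ}
/-! ## §1. The merger's terminal binder in abstract form; the located constant along the flow -/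

/-- **THE TERMINAL SUB-ADDITIVITY `htsub` OF THE MERGER IN ABSTRACT FORM** — the binder of
`B16Improved189FullBudget.mergeT_rhs_le` ∕ `mergeT_controls` in its exact shape, for ANY assignment of terminal terms to
the subfamilies that is non-negative (`ht0`) and bounded by one constant on the connected subfamilies (`htE`): `t(T) ≤
E_t ≤ t({x}) + t(T∖{x}) + E_t`.  Print's currency — `t(T) = κ₁·d(fineCubes R (S^K(∪T)))` with condition (i) at the
terminal scale — is the instance `B16Improved189ArbitraryRegion.htsub_of_condI` ∕ `htsub_binder_of_condI` (n13-d; total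
data over all `T`); this form asks the bound only where §4 uses it and is what `mergeT_controls_ofIndex` consumes.
[folklore] [cite: Balaban1989LargeFieldII, (1.85)–(1.88) pp.386–387] -/
theorem htsub_of_abs_bound {ι : Type*} [DecidableEq ι] (t : Finset ι → ℝ) (S : Finset ι)
    (Conn : Finset ι → Prop) (Et : ℝ) (ht0 : ∀ T, T ⊆ S → 0 ≤ t T)
    (htE : ∀ T, T ⊆ S → Conn T → t T ≤ Et) :
    ∀ T x, T ⊆ S → x ∈ T → 2 ≤ T.card → Conn T → Conn (T.erase x) →
      t T ≤ t {x} + t (T.erase x) + Et := by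
  intro T x hTS hx _ hT _
  have h1 : 0 ≤ t {x} := ht0 {x} (Finset.singleton_subset_iff.mpr (hTS hx))
  have h2 : 0 ≤ t (T.erase x) := ht0 (T.erase x) ((Finset.erase_subset x T).trans hTS)
  linarith [htE T hTS hT]

/-- (2.9)'s first member ([III] p. 255: `R_n ≦ LR_m`, `n > m`) read for `m ≤ n ≤ K_f` as naturals (the case `m = n`
by `L ≥ 1`). [cite: Balaban1988Convergent, (2.9) p.255] -/
theorem R_le_L_mul_of_flow {L Kf : ℕ} (hL1 : 1 ≤ L) (R : ℕ → ℕ)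
    (h29a : ∀ m n, m < n → n ≤ Kf → (R n : ℝ) ≤ L * R m) {m n : ℕ} (hmn : m ≤ n) (hn : n ≤ Kf) :
    R n ≤ L * R m := by
  rcases Nat.lt_or_ge m n with hlt | hge
  · exact_mod_cast h29a m n hlt hn
  · obtain rfl : m = n := le_antisymm hmn hge
    exact Nat.le_mul_of_pos_left _ (by omega)

/-- Hence `(Nsz·R_n)^d − 1 ≤ (Nsz·L·R_m)^d − 1` for `m ≤ n ≤ K_f` — the size of a cube of condition (i) at a LATER
scale against the located constant at the earlier one. [cite: Balaban1988Convergent, (2.9) p.255] -/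
theorem terminal_pow_le_of_flow {L Kf : ℕ} (hL1 : 1 ≤ L) (R : ℕ → ℕ)
    (h29a : ∀ m n, m < n → n ≤ Kf → (R n : ℝ) ≤ L * R m) {m n : ℕ} (hmn : m ≤ n) (hn : n ≤ Kf) (Nsz : ℕ) :
    ((Nsz : ℝ) * R n) ^ d - 1 ≤ ((Nsz : ℝ) * L * R m) ^ d - 1 := by
  have h : (R n : ℝ) ≤ L * R m := by exact_mod_cast R_le_L_mul_of_flow hL1 R h29a hmn hn
  have h1 : (Nsz : ℝ) * R n ≤ (Nsz : ℝ) * L * R m := mul_assoc (Nsz : ℝ) L (R m) ▸ mul_le_mul_of_nonneg_left h (Nat.cast_nonneg _)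
  linarith [pow_le_pow_left₀ (by positivity : (0 : ℝ) ≤ (Nsz : ℝ) * R n) h1 d]

/-- **THE LOCATED TERMINAL CONSTANT ALONG THE FLOW** (the reason behind the charges of §§2–5): a non-empty face-connected
index set `SK` (the terminal domain `S^K(Z)` at scale `n = j+K`) satisfying condition (i) with `Nsz` cubes per side has,
for `κ₁ ≥ 0`, terminal term `κ₁·d(fineCubes R_n SK) ≤ κ₁((Nsz·L·R_m)^d − 1)` for every earlier scale `m ≤ n` of the
flow — `B16Improved189ArbitraryRegion.terminal_le_const_of_condI` (n13-d) BY NAME with `R_max := L·R_m` from (2.9). [cite: Balaban1989LargeFieldII, p.384 (definition of K); Balaban1989LargeFieldI, p.177 (condition (i)); Balaban1988Convergent, (2.9) p.255] -/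
theorem terminal_le_located {L Kf : ℕ} (hL1 : 1 ≤ L) (R : ℕ → ℕ)
    (h29a : ∀ m n, m < n → n ≤ Kf → (R n : ℝ) ≤ L * R m) {m n : ℕ} (hmn : m ≤ n) (hn : n ≤ Kf)
    (hRn : 0 < R n) {Nsz : ℕ} {SK : Finset (Pt d)} (hne : SK.Nonempty) (hfc : FaceConnected SK)
    (hI : CondI Nsz SK) {κ₁ : ℝ} (hκ₁ : 0 ≤ κ₁) :
    κ₁ * treeLen (fineCubes (R n) SK) ≤ κ₁ * (((Nsz : ℝ) * L * R m) ^ d - 1) := by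
  simpa [Nat.cast_mul, mul_assoc] using
    terminal_le_const_of_condI hRn (R_le_L_mul_of_flow hL1 R h29a hmn hn) hne hfc hI hκ₁

/-! ## §2. «The first induction step» WITH THE TERM, in the index model -/

/-- **(1.80)⁺ AT THE CREATION SCALE IN THE INDEX MODEL, END TO END.**  The hypotheses of
`B16Lem384Induction.controls_ofIndex` verbatim — a flow of [III] §2 on `[0, K_f]` (`hI`, `hγ1`, (2.5) `hR`/`hbR`,
(2.9a) `h29a`, (2.7) `h27`, the located smallness `hΘ`, `L ≥ 4`, `O(1), M ≥ 0`), a non-empty face-connected region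
`Z ⊆ ℤᵈ` of `MR_m`-cube indices BORN AT SCALE `m` with a horizon `K` inside the flow not exceeding a stopping index
(`hKmin`; (ii)'s cleanliness `Clean` after the creation scale) — PLUS what the terminal term asks: `κ₁ ≥ 0`, condition
(i) for the terminal iterate `S^K(Z)` (`hIK`: the definition of `K`, p. 384), the located clause
`κ₁((Nsz·R_{m+K})^d − 1) ≤ Q` on `κ₁` (`Q = 10·126^d·O(1)M^{d_b}L^{d_b+1}R_m^{d_b+2}`, the cell's (1.81)-constant) and
print's located condition with `3` for `2` (`hcond3`; «satisfied for p₀ large, and g₁ sufficiently small»).  THEN the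
(1.82)-budget `a·(d′_m(Z) + 1) − O(1)M^dR_m^{d+1}d′_m(Z)` LOWERED BY THE TERMINAL TERM `κ₁·d_{m+K}(S^K(Z))` (M-cube
tree length of the terminal iterate) controls the `K` steps: (1.80)⁺ at scale `m`.  `exists_birth_ofIndex` ∘
`ht_of_condI` ∘ `bornT_controls`. [cite: Balaban1989LargeFieldII, (1.80)–(1.82) pp.384–385] -/
theorem controlsT_birth_ofIndex (b : Budget.Consts) {L p Kf : ℕ} (hL : 4 ≤ L) {g : ℕ → ℝ} {γ β' β₀ : ℝ}
    (hI : Step.InInterval γ Kf g) (hγ1 : γ ≤ 1) (R : ℕ → ℕ)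
    (hR : ∀ n, n ≤ Kf → B14.IsRj L p (g n) (R n)) (hbR : ∀ n, n ≤ Kf → b.R n = (R n : ℝ))
    (h29a : ∀ m n, m < n → n ≤ Kf → (R n : ℝ) ≤ L * R m) (h27 : B14.FlowIneq27 g β' β₀ p Kf)
    (hΘ : ∀ m n, m < n → n ≤ Kf → (1 + (g n) ^ 2 * β' * ((n : ℝ) - m)) ^ β₀ ≤ (L : ℝ) ^ (max (n - m) 2 / 2))
    (hC : 0 ≤ b.C) (hM : 0 ≤ b.M) {Z : Finset (Pt d)} (hZ : Z.Nonempty) (hZc : FaceConnected Z)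
    (m K : ℕ) (hmK : m + K ≤ Kf) (Nsz : ℕ) (hNsz : 64 ≤ Nsz) (Clean : ℕ → Prop)
    (hclean : ∀ l, 1 ≤ l → l ≤ Kf - m → Clean l)
    (hKmin : ∀ K', StopAt Nsz (R m) Clean (fun i => Siter (ratio L (fun i => Nat.log L (R (m + i)))) i Z) K' → K ≤ K')
    (hIK : CondI Nsz (Siter (ratio L (fun i => Nat.log L (R (m + i)))) K Z))
    {κ₁ : ℝ} (hκ₁ : 0 ≤ κ₁)
    (hclause : κ₁ * (((Nsz : ℝ) * R (m + K)) ^ d - 1) ≤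
      10 * 126 ^ d * (b.C * b.M ^ b.d * (L : ℝ) ^ (b.d + 1) * b.R m ^ (b.d + 2)))
    (a : ℝ) (hcond3 : 3 * (10 * 126 ^ d * (b.C * b.M ^ b.d * (L : ℝ) ^ (b.d + 1) * b.R m ^ (b.d + 2))) ≤ a) :
    Controls b m K (a * (treeLen Z + 1) - b.cost m (treeLen Z)
        - κ₁ * treeLen (fineCubes (R (m + K)) (Siter (ratio L (fun i => Nat.log L (R (m + i)))) K Z)))
      (fun n => treeLen (Siter (ratio L (fun i => Nat.log L (R (m + i)))) (n - m) Z)) := by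
  have hRm : b.R m = ((R m : ℕ) : ℝ) := hbR m (by omega)
  have hQ0 : 0 ≤ 10 * 126 ^ d * (b.C * b.M ^ b.d * (L : ℝ) ^ (b.d + 1) * b.R m ^ (b.d + 2)) := by
    rw [hRm]; positivity
  obtain ⟨x, ha, hd, hK, hQ, hs⟩ := exists_birth_ofIndex b hL hI hγ1 R hR hbR h29a h27 hΘ hC hM hZ hZc m K hmK Nsz
    hNsz Clean hclean hKmin a (by linarith)
  have hσ := exponents_log (show 1 < L by omega) R hR
  have hR0 : 0 < R (m + K) := by
    rw [(hσ (m + K) hmK).1]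
    exact Nat.one_le_pow _ _ (by omega)
  have hne := Siter_nonempty (ratio L (fun i => Nat.log L (R (m + i)))) hZ K
  have hfc := faceConnected_Siter (q := ratio L (fun i => Nat.log L (R (m + i))))
    (fun l => ratio_pos (show 0 < L by omega) _ l) hZc K
  have ht := ht_of_condI hR0 hne hfc hIK hκ₁ (treeLen_nonneg Z) hclause
  have hrhs := x.hrhs
  have hcost := x.hcost
  rw [hK, hQ, hd, hs] at hrhs
  rw [hQ, hd] at hcost
  exact bornT_controls b m K _ a _ _ (treeLen Z) _ (treeLen_nonneg Z) le_rfl hrhs hcost ht hcond3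

/-! ## §3. The reset of p. 386 WITH THE TERM, in the index model -/

/-- **(1.80)⁺ FOR THE RESET COMPONENT IN THE INDEX MODEL, END TO END** («We define κ_{j+1}(Z) = p₀(g_j) −
O(1)M^dR_{j+1}^{d+1}d′_{j+1}(Z). It satisfies (1.80), because Z is a small domain, it is contained in a cube of the size
100MR_{j+1}, hence K = R_{j+1} for Z»).  The hypotheses of `B16Lem384Induction.controls_reset_ofIndex` verbatim (the
flow; `Z₀ ⊆ □_c^{~r₀}`, `r₀ ≥ 22` — condition (i) at scale `j`; the reset component `Z = S(Z₀)` with a horizon `K`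
inside the flow not exceeding a stopping index for the memory `R_{j+1}` and `Nsz ≥ 2r₀ + 21`) with `κ₁ ≥ 0` and the
located condition CHARGED WITH THE TERMINAL CONSTANT: `hcondRT : 2(2r₀+21)^d·O(1)M^{d_b}L^{d_b+1}R_{j+1}^{d_b+2} +
κ₁((Nsz·R_{j+1+K})^d − 1) ≤ p`.  Condition (i) for the terminal iterate `S^K(Z)` is DERIVED («Z is a small domain»:
`Siter_subset_box_of_subset_box`, `condI_of_subset_box`), the terminal term `κ₁·d_{j+1+K}(S^K(Z))` is bounded by
`terminal_treeLen_le_of_condI`, and `resetT_p386` concludes: the budget `p − O(1)M^{d_b}R_{j+1}^{d_b+1}d′_{j+1}(Z)`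
LOWERED BY THE TERMINAL TERM controls the `K` steps of `Z`. [cite: Balaban1989LargeFieldII, §1 p.385 (last lines)–p.386 l.1-3 (the reset)] -/
theorem controlsT_reset_ofIndex (b : Budget.Consts) {j : ℕ} (D : ScaleData j) (Z₀c : D.Comp) (hK0 : D.K Z₀c = 0)
    {L p Kf : ℕ} (hL : 4 ≤ L) {g : ℕ → ℝ} {γ β' β₀ : ℝ} (hI : Step.InInterval γ Kf g) (hγ1 : γ ≤ 1)
    (R : ℕ → ℕ) (hR : ∀ n, n ≤ Kf → B14.IsRj L p (g n) (R n)) (hbR : ∀ n, n ≤ Kf → b.R n = (R n : ℝ))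
    (h29a : ∀ m n, m < n → n ≤ Kf → (R n : ℝ) ≤ L * R m) (h27 : B14.FlowIneq27 g β' β₀ p Kf)
    (hΘ : ∀ m n, m < n → n ≤ Kf → (1 + (g n) ^ 2 * β' * ((n : ℝ) - m)) ^ β₀ ≤ (L : ℝ) ^ (max (n - m) 2 / 2))
    (hC : 0 ≤ b.C) (hM : 0 ≤ b.M) {Z₀ : Finset (Pt d)} (hZ₀ : Z₀.Nonempty) (hZ₀c : FaceConnected Z₀)
    {c : Pt d} {r₀ : ℕ} (hr₀ : 22 ≤ r₀) (hZ₀box : Z₀ ⊆ box c r₀)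
    (K : ℕ) (hmK : j + 1 + K ≤ Kf) (Nsz : ℕ) (hNsz : 2 * r₀ + 21 ≤ Nsz) (Clean : ℕ → Prop)
    (hclean : ∀ l, 1 ≤ l → l ≤ Kf - (j + 1) → Clean l)
    (hKmin : ∀ K', StopAt Nsz (R (j + 1)) Clean
      (fun i => Siter (ratio L (fun i => Nat.log L (R (j + 1 + i)))) i
        (Sop (ratio L (fun i => Nat.log L (R (j + i))) 0) Z₀)) K' → K ≤ K')
    {κ₁ : ℝ} (hκ₁ : 0 ≤ κ₁) (pR : ℝ)
    (hcondRT : 2 * (2 * (r₀ : ℝ) + 21) ^ d * (b.C * b.M ^ b.d * (L : ℝ) ^ (b.d + 1) * b.R (j + 1) ^ (b.d + 2))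
      + κ₁ * (((Nsz : ℝ) * R (j + 1 + K)) ^ d - 1) ≤ pR) :
    Controls b (j + 1) K
      (pR - b.cost (j + 1) (treeLen (Sop (ratio L (fun i => Nat.log L (R (j + i))) 0) Z₀))
        - κ₁ * treeLen (fineCubes (R (j + 1 + K))
            (Siter (ratio L (fun i => Nat.log L (R (j + 1 + i)))) K
              (Sop (ratio L (fun i => Nat.log L (R (j + i))) 0) Z₀))))
      (fun n => treeLen (Siter (ratio L (fun i => Nat.log L (R (j + 1 + i)))) (n - (j + 1))
        (Sop (ratio L (fun i => Nat.log L (R (j + i))) 0) Z₀))) := by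
  have hL3 : 3 ≤ L := by omega
  have hσ := exponents_log (show 1 < L by omega) R hR
  have hdrop := dropCtl_of_27b (by omega) hI hγ1 R (fun n => Nat.log L (R n)) hσ h27 hΘ
  have hD : DropCtl (fun i => Nat.log L (R (j + i))) (Kf - j) := dropCtl_shift hdrop
  -- «Z is a small domain»: the terminal iterate `S^K(Z) = S^{K+1}(Z₀)` lies in a box of radius `r₀ + 10`
  obtain ⟨c', hsub⟩ := Siter_subset_box_of_subset_box hL3 hD hr₀ hZ₀box (i := K + 1) (by omega)
  rw [Siter_shift_log L R j K Z₀] at hsub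
  have hIK : CondI Nsz (Siter (ratio L (fun i => Nat.log L (R (j + 1 + i)))) K
      (Sop (ratio L (fun i => Nat.log L (R (j + i))) 0) Z₀)) :=
    (condI_of_subset_box hsub).mono (by omega)
  have hR0 : 0 < R (j + 1 + K) := by
    rw [(hσ (j + 1 + K) hmK).1]
    exact Nat.one_le_pow _ _ (by omega)
  have hq0 : 0 < ratio L (fun i => Nat.log L (R (j + i))) 0 := ratio_pos (show 0 < L by omega) _ 0
  have hZne := Sop_nonempty (ratio L (fun i => Nat.log L (R (j + i))) 0) hZ₀
  have hZfc := faceConnected_Sop hq0 hZ₀c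
  have hne := Siter_nonempty (ratio L (fun i => Nat.log L (R (j + 1 + i)))) hZne K
  have hfc := faceConnected_Siter (q := ratio L (fun i => Nat.log L (R (j + 1 + i))))
    (fun l => ratio_pos (show 0 < L by omega) _ l) hZfc K
  have htb := mul_le_mul_of_nonneg_left (terminal_treeLen_le_of_condI hR0 hne hfc hIK) hκ₁
  obtain ⟨x, -, hp, hK, hs⟩ := exists_reset_ofIndex b D Z₀c hK0 hL hI hγ1 R hR hbR h29a h27 hΘ hC hM hZ₀ hZ₀c
    hr₀ hZ₀box K hmK Nsz hNsz Clean hclean hKmin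
    (pR - κ₁ * treeLen (fineCubes (R (j + 1 + K))
      (Siter (ratio L (fun i => Nat.log L (R (j + 1 + i)))) K
        (Sop (ratio L (fun i => Nat.log L (R (j + i))) 0) Z₀)))) (by linarith)
  have hsmall := x.hsmall
  rw [hK, hp, hs] at hsmall
  have key : ∀ (t : ℝ) (s : ℕ → ℝ), (∑ n ∈ Finset.Ioc j (j + 1 + K), b.cost n (s n) ≤ pR - t) →
      Controls b (j + 1) K (pR - b.cost (j + 1) (s (j + 1)) - t) s := fun t s h =>
    resetT_p386 b j K pR t s (by linarith)
  have h := key _ _ hsmall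
  simpa using h

/-! ## §4. The merger (1.85)–(1.88) WITH THE TERM over `MergeIndex` data -/

/-- **(1.80)⁺ FOR THE MERGED COMPONENT IN INDEX FORM.**  Data: a merger `M : MergeIndex b D ι d` of
`B16Lem384Induction` §7 (regions `P x ⊆ ℤᵈ` with admissible trees, the touch graph of (1.84) connected on the family,
sizes = tree lengths, `2p₀(g_{j(·)})`-terms = `pFam` under (2.7a), print's `hsub`, the merged component's `K`/`size` with
`hrhsZ`); (1.80)⁺ AT SCALE `j` with terminal terms `tD` (`hDT`, the strengthened inductive hypothesis); terminal terms `t`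
of the sub-unions at scale `j+1`, non-negative (`ht0`) and ABSOLUTELY BOUNDED on connected sub-unions by a located
constant `E_t` (`htE`; print's currency: `terminal_le_located`); on single pieces an old piece's term is at most its term
at scale `j` (`ht1_old` — the SAME terminal domain, `S^{K−1}(S(Z₀)) = S^K(Z₀)`), a new piece's is at most `Q(d′+1)` under
`3Q ≤ a` (`ht1_new`); and «for p₀ large and γ small enough» charged with `E_t`: `hbudgetT : E + E_t +
O(1)M^dR_{j+1}^{d+1}·2 ≤ 2(1+β₀)⁻¹p₀(g_{j+1})`.  THEN for every `t_Z ≤ t(S)` the budget (1.85) (`MergeCase.κ'` of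
`M.toMergeCase`) LOWERED BY `t_Z` controls the `K` steps of the merged component — `mergeT_controls` with
`hleaf`/`hP`/`hc`/`hsub` from `M.toMergeCase`, `hsingleT` from `hsingleT_old`/`hsingleT_new`, `htsub` from §1 (`htsub_of_abs_bound`). [cite: Balaban1989LargeFieldII, (1.84)–(1.88) pp.386–387] -/
theorem mergeT_controls_ofIndex (b : Budget.Consts) {j : ℕ} {D : ScaleData j} {ι : Type} [DecidableEq ι]
    (M : MergeIndex b D ι d) (tD : D.Comp → ℝ)
    (hDT : ∀ Z, Controls b j (D.K Z) (D.κ Z - tD Z) (D.size Z))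
    (t : Finset ι → ℝ) (ht0 : ∀ T, T ⊆ M.S → 0 ≤ t T) (Et : ℝ)
    (htE : ∀ T, T ⊆ M.S → GConn (touchGraph M.P) T → t T ≤ Et)
    (ht1_old : ∀ x ∈ M.S, ∀ y : OldPiece D, M.prov x = Piece.old y → t {x} ≤ tD y.Z₀)
    (ht1_new : ∀ x ∈ M.S, ∀ y : Birth b (j + 1), M.prov x = Piece.new y →
      t {x} ≤ y.Q * (y.d' + 1) ∧ 3 * y.Q ≤ y.a)
    (hbudgetT : M.E + Et + b.cost (j + 1) 2 ≤ 2 * (1 + M.β₀)⁻¹ * p0Profile M.A₀ M.p₀ (M.g (j + 1)))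
    (tZ : ℝ) (htZ : tZ ≤ t M.S) :
    Controls b (j + 1) M.K (M.toMergeCase.κ' - tZ) M.size := by
  have hsingleT : ∀ x ∈ M.toMergeCase.S, M.toMergeCase.rhs {x} + t {x} ≤
      merge M.toMergeCase.contrib {x} (M.toMergeCase.cost {x}) (M.toMergeCase.Pf {x}) := by
    intro x hx
    have hx' : x ∈ M.S := hx
    have hrhs1 : M.toMergeCase.rhs {x} = (M.prov x).rhs180 b := M.hrhs1 x hx'
    have hcost1 : M.toMergeCase.cost {x} = b.cost (j + 1) (M.prov x).d1 := M.toMergeCase.hcost1 x hx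
    rw [hrhs1]
    unfold merge MergeCase.contrib
    rw [Finset.sum_singleton, hcost1]
    show (M.prov x).rhs180 b + t {x} ≤
      (M.prov x).base + M.toMergeCase.Pf {x} - b.cost (j + 1) (M.prov x).d1 - M.toMergeCase.Pf {x}
    suffices h : (M.prov x).rhs180 b + t {x} ≤ (M.prov x).base - b.cost (j + 1) (M.prov x).d1 by linarith
    rcases hpx : M.prov x with y | y
    · have h := hsingleT_old b j (D.K y.Z₀) y.hK (D.κ y.Z₀) (tD y.Z₀) (D.size y.Z₀) (hDT y.Z₀)
      have h1 := ht1_old x hx' y hpx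
      show (∑ n ∈ Finset.Ioc (j + 1) (j + 1 + (D.K y.Z₀ - 1)), b.cost n (D.size y.Z₀ n)) + t {x} ≤
        D.κ y.Z₀ - b.cost (j + 1) (D.size y.Z₀ (j + 1))
      linarith
    · have h1 := ht1_new x hx' y hpx
      exact hsingleT_new b (j + 1) y.K y.a y.Q (t {x}) y.d' y.size y.hd' y.hrhs y.hcost h1.1 h1.2
  exact mergeT_controls b j M.toMergeCase.contrib M.toMergeCase.cost M.toMergeCase.Pf M.toMergeCase.rhs t
    M.toMergeCase.S M.toMergeCase.hne M.toMergeCase.Conn M.toMergeCase.hconn M.toMergeCase.q M.toMergeCase.E Et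
    M.toMergeCase.Dc M.toMergeCase.hleaf hsingleT M.toMergeCase.hP M.toMergeCase.hc M.toMergeCase.hsub
    (htsub_of_abs_bound t M.S _ Et ht0 htE) hbudgetT M.K M.size _ tZ M.toMergeCase.hrhsZ htZ le_rfl

/-! ## §5. The step from certificates; the base from index regions; the full-budget capstone -/

/-- THE STEP `j → j+1` OF (1.80)⁺ FROM ONE PRINTED-CASE CERTIFICATE PER COMPONENT (the `Transition` of
`B16Lem384Induction` §4 in proposition form): if every component `Z` of the scale-`j+1` data comes with a certified
budget `κc ≤ κ_{j+1}(Z)` for which (1.80)⁺ holds with `Z`'s horizon, profile and terminal term — supplied by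
`case1T_183` (continuation), `controlsT_reset_ofIndex` (reset), `controlsT_birth_ofIndex` (lone new region) or
`mergeT_controls_ofIndex` (merger) — then (1.80)⁺ holds for every component at scale `j+1` (`controlsT_mono`: budgets
enter as LOWER bounds by the case values, (1.82) being an inequality). [cite: Balaban1989LargeFieldII, pp.385–387] -/
theorem invariantT_succ_of_certificates (b : Budget.Consts) {j : ℕ} (D' : ScaleData (j + 1)) (t' : D'.Comp → ℝ)
    (hcert : ∀ Z, ∃ κc, κc ≤ D'.κ Z ∧ Controls b (j + 1) (D'.K Z) (κc - t' Z) (D'.size Z)) :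
    ∀ Z, Controls b (j + 1) (D'.K Z) (D'.κ Z - t' Z) (D'.size Z) := by
  intro Z
  obtain ⟨κc, hle, hC⟩ := hcert Z
  exact controlsT_mono b (j + 1) (D'.K Z) (D'.size Z) hC hle le_rfl

/-- **(1.80)⁺ AT THE FIRST SCALE FOR BOOKKEEPING DATA READ FROM INDEX REGIONS** (p. 385, `m = 1`: «Take a component Z of
the region Z₁» — every component a first induction step, now with its terminal term): the hypotheses of
`B16Lem384Induction.invariant_base_ofIndex` verbatim (scale-`m` data `D` whose components carry non-empty face-connected
index regions `reg Z` born at `m` along one flow, size profiles = the tree-length profiles of the iterates, horizons inside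
the flow not exceeding a stopping index, budgets dominating the (1.82)-budget for one coefficient `a`) PLUS: `κ₁ ≥ 0`,
condition (i) for every component's terminal iterate (`hIK`), ONE located clause `κ₁((Nsz·L·R_m)^d − 1) ≤ Q` (uniform in
the component by (2.9a), `terminal_pow_le_of_flow`), print's condition with `3` for `2`, and terminal terms `t Z` not
exceeding print's candidate `κ₁·d_{m+K}(S^K(reg Z))` (equality is the instance).  THEN (1.80)⁺ holds at scale `m` for
every component. [cite: Balaban1989LargeFieldII, (1.82) p.385] -/
theorem invariantT_base_ofIndex (b : Budget.Consts) {m : ℕ} (D : ScaleData m) {L p Kf : ℕ} (hL : 4 ≤ L) {g : ℕ → ℝ}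
    {γ β' β₀ : ℝ} (hI : Step.InInterval γ Kf g) (hγ1 : γ ≤ 1) (R : ℕ → ℕ)
    (hR : ∀ n, n ≤ Kf → B14.IsRj L p (g n) (R n)) (hbR : ∀ n, n ≤ Kf → b.R n = (R n : ℝ))
    (h29a : ∀ m n, m < n → n ≤ Kf → (R n : ℝ) ≤ L * R m) (h27 : B14.FlowIneq27 g β' β₀ p Kf)
    (hΘ : ∀ m n, m < n → n ≤ Kf → (1 + (g n) ^ 2 * β' * ((n : ℝ) - m)) ^ β₀ ≤ (L : ℝ) ^ (max (n - m) 2 / 2))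
    (hC : 0 ≤ b.C) (hM : 0 ≤ b.M) (reg : D.Comp → Finset (Pt d)) (hne : ∀ Z, (reg Z).Nonempty)
    (hfc : ∀ Z, FaceConnected (reg Z)) (hKf : ∀ Z, m + D.K Z ≤ Kf) (Nsz : ℕ) (hNsz : 64 ≤ Nsz)
    (Clean : D.Comp → ℕ → Prop) (hclean : ∀ Z l, 1 ≤ l → l ≤ Kf - m → Clean Z l)
    (hKmin : ∀ Z K', StopAt Nsz (R m) (Clean Z)
      (fun i => Siter (ratio L (fun i => Nat.log L (R (m + i)))) i (reg Z)) K' → D.K Z ≤ K')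
    (hsize : ∀ Z, D.size Z = fun n => treeLen (Siter (ratio L (fun i => Nat.log L (R (m + i)))) (n - m) (reg Z)))
    (hIK : ∀ Z, CondI Nsz (Siter (ratio L (fun i => Nat.log L (R (m + i)))) (D.K Z) (reg Z)))
    {κ₁ : ℝ} (hκ₁ : 0 ≤ κ₁)
    (hclauseU : κ₁ * (((Nsz : ℝ) * L * R m) ^ d - 1) ≤
      10 * 126 ^ d * (b.C * b.M ^ b.d * (L : ℝ) ^ (b.d + 1) * b.R m ^ (b.d + 2)))
    (a : ℝ) (hcond3 : 3 * (10 * 126 ^ d * (b.C * b.M ^ b.d * (L : ℝ) ^ (b.d + 1) * b.R m ^ (b.d + 2))) ≤ a)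
    (h182 : ∀ Z, a * (treeLen (reg Z) + 1) - b.cost m (treeLen (reg Z)) ≤ D.κ Z)
    (t : D.Comp → ℝ)
    (ht : ∀ Z, t Z ≤ κ₁ * treeLen (fineCubes (R (m + D.K Z))
      (Siter (ratio L (fun i => Nat.log L (R (m + i)))) (D.K Z) (reg Z)))) :
    ∀ Z, Controls b m (D.K Z) (D.κ Z - t Z) (D.size Z) := by
  intro Z
  have hclause : κ₁ * (((Nsz : ℝ) * R (m + D.K Z)) ^ d - 1) ≤
      10 * 126 ^ d * (b.C * b.M ^ b.d * (L : ℝ) ^ (b.d + 1) * b.R m ^ (b.d + 2)) :=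
    le_trans (mul_le_mul_of_nonneg_left
      (terminal_pow_le_of_flow (by omega) R h29a (Nat.le_add_right m (D.K Z)) (hKf Z) Nsz) hκ₁) hclauseU
  have h := controlsT_birth_ofIndex b hL hI hγ1 R hR hbR h29a h27 hΘ hC hM (hne Z) (hfc Z) m (D.K Z) (hKf Z) Nsz
    hNsz (Clean Z) (hclean Z) (hKmin Z) (hIK Z) hκ₁ hclause a hcond3
  rw [hsize Z]
  exact controlsT_mono b m (D.K Z) _ h (h182 Z) (ht Z)

/-- **THE FULL-BUDGET CAPSTONE IN THE INDEX MODEL** — p. 387 ll. 25–29 «an improved bound (1.89), with the additional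
term −κ₁d_k(X) in the exponential» WITH THE PRINTED BUDGET `2(1+β₀)⁻¹p₀(g_k)`: bookkeeping data `D j` with terminal terms
`t j` whose FIRST-SCALE components (`j₀`; print `j₀ = 1`) satisfy the hypotheses of `invariantT_base_ofIndex`, a
(1.80)⁺-step at every scale `j ≥ j₀` (assembled per component by `invariantT_succ_of_certificates`), and a horizon-`0`
component `X` of `Z_k`, `k ≥ j₀`, whose terminal term dominates `κ₁·d(X)` (`hd`; equality for print's candidate) and whose
factor has the p. 384 form `𝐓′1 ≤ exp(−κ_k(X) − P)`, `P ≥ 2(1+β₀)⁻¹p₀(g_k)`: THEN `𝐓′_k(X)1 ≤ exp(−2(1+β₀)⁻¹p₀(g_k) −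
κ₁d(X))`.  `invariantT_base_ofIndex` ∘ `invariantT_all` ∘ `improved189_full_of_invariantT`. [cite: Balaban1989LargeFieldII, (1.80) p.384, (1.82) p.385, (1.89) p.387 ll.25–29] -/
theorem improved189_full_ofIndex (b : Budget.Consts) (D : (j : ℕ) → ScaleData j)
    (t : (j : ℕ) → (D j).Comp → ℝ) (j₀ : ℕ) {L p Kf : ℕ} (hL : 4 ≤ L) {g : ℕ → ℝ}
    {γ β' β₀f : ℝ} (hI : Step.InInterval γ Kf g) (hγ1 : γ ≤ 1) (R : ℕ → ℕ)
    (hR : ∀ n, n ≤ Kf → B14.IsRj L p (g n) (R n)) (hbR : ∀ n, n ≤ Kf → b.R n = (R n : ℝ))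
    (h29a : ∀ m n, m < n → n ≤ Kf → (R n : ℝ) ≤ L * R m) (h27 : B14.FlowIneq27 g β' β₀f p Kf)
    (hΘ : ∀ m n, m < n → n ≤ Kf → (1 + (g n) ^ 2 * β' * ((n : ℝ) - m)) ^ β₀f ≤ (L : ℝ) ^ (max (n - m) 2 / 2))
    (hC : 0 ≤ b.C) (hM : 0 ≤ b.M) (reg : (D j₀).Comp → Finset (Pt d)) (hne : ∀ Z, (reg Z).Nonempty)
    (hfc : ∀ Z, FaceConnected (reg Z)) (hKf : ∀ Z, j₀ + (D j₀).K Z ≤ Kf) (Nsz : ℕ) (hNsz : 64 ≤ Nsz)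
    (Clean : (D j₀).Comp → ℕ → Prop) (hclean : ∀ Z l, 1 ≤ l → l ≤ Kf - j₀ → Clean Z l)
    (hKmin : ∀ Z K', StopAt Nsz (R j₀) (Clean Z)
      (fun i => Siter (ratio L (fun i => Nat.log L (R (j₀ + i)))) i (reg Z)) K' → (D j₀).K Z ≤ K')
    (hsize : ∀ Z, (D j₀).size Z =
      fun n => treeLen (Siter (ratio L (fun i => Nat.log L (R (j₀ + i)))) (n - j₀) (reg Z)))
    (hIK : ∀ Z, CondI Nsz (Siter (ratio L (fun i => Nat.log L (R (j₀ + i)))) ((D j₀).K Z) (reg Z)))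
    {κ₁ : ℝ} (hκ₁ : 0 ≤ κ₁)
    (hclauseU : κ₁ * (((Nsz : ℝ) * L * R j₀) ^ d - 1) ≤
      10 * 126 ^ d * (b.C * b.M ^ b.d * (L : ℝ) ^ (b.d + 1) * b.R j₀ ^ (b.d + 2)))
    (a : ℝ) (hcond3 : 3 * (10 * 126 ^ d * (b.C * b.M ^ b.d * (L : ℝ) ^ (b.d + 1) * b.R j₀ ^ (b.d + 2))) ≤ a)
    (h182 : ∀ Z, a * (treeLen (reg Z) + 1) - b.cost j₀ (treeLen (reg Z)) ≤ (D j₀).κ Z)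
    (ht₀ : ∀ Z, t j₀ Z ≤ κ₁ * treeLen (fineCubes (R (j₀ + (D j₀).K Z))
      (Siter (ratio L (fun i => Nat.log L (R (j₀ + i)))) ((D j₀).K Z) (reg Z))))
    (hstep : ∀ j, j₀ ≤ j → (∀ Z, Controls b j ((D j).K Z) ((D j).κ Z - t j Z) ((D j).size Z)) →
      ∀ Z, Controls b (j + 1) ((D (j + 1)).K Z) ((D (j + 1)).κ Z - t (j + 1) Z) ((D (j + 1)).size Z))
    {k : ℕ} (hk : j₀ ≤ k) (X : (D k).Comp) (hK : (D k).K X = 0) (dX : (D k).Comp → ℝ)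
    (hd : κ₁ * dX X ≤ t k X) {V : Type*} (T1X : V → ℝ) (A₀ : ℝ) (p₀ : ℕ) (β₀ gk P : ℝ)
    (hT : ∀ v, T1X v ≤ Real.exp (-(D k).κ X - P)) (hP : 2 * (1 + β₀)⁻¹ * p0Profile A₀ p₀ gk ≤ P) :
    ∀ v, T1X v ≤ Real.exp (-(2 * (1 + β₀)⁻¹ * p0Profile A₀ p₀ gk) - κ₁ * dX X) :=
  improved189_full_of_invariantT b (t k)
    (invariantT_all b D t j₀
      (invariantT_base_ofIndex b (D j₀) hL hI hγ1 R hR hbR h29a h27 hΘ hC hM reg hne hfc hKf Nsz hNsz Clean hclean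
        hKmin hsize hIK hκ₁ hclauseU a hcond3 h182 (t j₀) ht₀) hstep k hk)
    X hK κ₁ dX hd T1X A₀ p₀ β₀ gk P hT hP

end
end Literature.MathematicalPhysics.QuantumFieldTheory.Balaban1983to89.B16Improved189FullBudgetIndex
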